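/-
Copyright (c) 2026. All rights reserved.
Released under Apache 2.0 license as described in the file LICENSE.
Authors: abc-iut cell, wave-5 seat abc-iut-w5-d141 (L3 sub-DAG [SemiAnbd] Thm 5.4, umbrella junction v5: parametric `ι`).
-/
import Literature.AnabelianGeometry.SemiGraphs.ArithThm54iiiUmbrellaOfChart
import Literature.AnabelianGeometry.SemiGraphs.ArithIotaOfChartDict
import Literature.AnabelianGeometry.SemiGraphs.TemperedCompactInVerticialFinite
import Literature.AnabelianGeometry.SemiGraphs.ArithThm54iiiUmbrellaOfDictionary
import HarnessLib

/-!
# [SemiAnbd] Theorem 5.4 (iii), COMPATIBLE reading, at the produced decomposition data with the datum `ι g`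
# READ THROUGH THE CHARTS (junction v5, «parametric ι»; proof-only)

Mochizuki, *Semi-graphs of anabelioids*, Publ. RIMS **42** (2006), §5, Theorem 5.4 (iii) p. 66, with the data of p. 65
and Prop 5.2 (iv) p. 64; §3 Prop 3.2 p. 35, Prop 3.6 (iv) p. 39, Cor 3.9 pp. 42–43
[cite: MochizukiSemiAnbd2006, Thm 5.4 (iii), p. 66].

PROOF-ONLY (no definition, nothing asserted; cell abc-iut, layer L3, T54 junction one-writer umbrella lineage
abc-iut-w5-d141; abc-iut-w4-d053's «ι g SHAPE RULING» 2026-08-26).  Junction v4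
(`arithQuasiGeometricCorrespondenceStatementCompat_ofChart`, `ArithThm54iiiUmbrellaOfChart.lean`) concludes
abc-iut-w4-d083's `ArithQuasiGeometricCorrespondenceStatementCompat 𝔊 ℍ e augG augH btemp` at the PRODUCED decomposition
data over the tempered charts `c𝒢`, `cℋ`, but still binds an ABSTRACT datum `ι : (𝔾 ⟶ ℍ') → (Ker aug_𝔊 →* Π^temp_ℍ)`
("`B^temp(g)` on the geometric tempered groups") with EIGHT properties `hιG hιH hιinj hιbtemp hιgeomV hιgeomE hιgeomC` and
the junction binder `hCor39c` whose last line is phrased through `ι`.  Here `ι` is NO LONGER A BINDER: it is read through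
the charts — `ι g (ι_𝔾 y) = ι_ℍ (φ̂ g y)` for chart-level representatives `φ̂ g : π₁^temp(𝔾) → π₁^temp(ℍ')` (Prop 3.2) of a
DICTIONARY `dict g : Hom 𝔾 ℍ'` (abc-iut-L3-t2's morphisms of semi-graphs of anabelioids) with chosen 2-cells `θ g`
(Rmk 2.4.2; cell finding RQ12) — and the eight properties + `hCor39c` are DISCHARGED (`ArithIotaOfChartDict.lean`, this
seat) from:
* (D1)/(D2) `dict`, `θd`, `hlo` (every arrow of the container is locally open, Rmk 2.4.2 / Def 5.1 (iv)), `φ̂`, `hφ̂`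
  (`(dict g)^*_{θ g} ≅ B^temp(φ̂ g)`, abc-iut-L3-t10's `Hom.chartPullbackWith`);
* (D1c) `hfaith` — the dictionary is faithful up to 2-isomorphism; (D1-full) `hfull` — it is full on locally open
  arrows up to 2-isomorphism (for the last line of `hCor39c`);
* (D1a)/(D1b) `hpre` / `hpost` — functoriality 2-isomorphisms with the graph actions `F𝒢`, `Fℋ` of `Π_A` on `𝔾`, `ℍ'`
  (Def 5.1 (i); abc-iut-w4-d082's `…_of_graphAction` currency), and `hact𝒢` / `hactℋ` — conjugation by
  `γ ∈ Π^temp_𝔊` on `ι_𝔾(π₁^temp 𝔾)` represents `(F𝒢 (aug γ))^*` (Prop 3.6 (iv) at `ρ(aug γ)`, Prop 5.2 (iv); the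
  Hom-level form of `ArithChartAction.conj_verticial`; for the outer-semidirect-product model:
  `conjSubgroup_map_toOuterSemidirectProduct`);
* `hbtempφ` — the arithmetic `B^temp(φ)` restricts on `ι_𝔾(π₁^temp 𝔾)` to `ι_ℍ ∘ φ̂ (φ_𝔾)` up to
  `Ker(aug_ℍ)`-conjugacy (the compatibility requirement on the producer of `B^temp`, formerly `hιbtemp`);
via abc-iut-w4-d083's `iotaShadows_of_compatVAt` (p. 66 ↔ Cor 3.9 (a) at the pair) and
`exists_hom_chartPullbackWith_iso_of_kernelShadows` (↔ Cor 3.9 (b) at the pair), abc-iut-L3-t10's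
`Hom.conj_of_chartPullbackWith_iso(_edge)`, and Prop 3.2 (`BTemp.exists_conj_of_natTrans`, `BTemp.resIsoOfConj`).
New chart-side hypotheses w.r.t. v4 (the exact inputs of those two theorems): `hℋiii : CompactInVerticialAt ℋ`,
`hℋ : Cor39Hypotheses ℋ`, `hι𝒢c : Continuous ι𝒢`, `hιℋe : IsEmbedding ιℋ`.
At a pair of FINITE graphs of anabelioids (the case [IUTchI] consumes: dual semi-graphs of special fibres) the two
Thm 3.7 (iii) binders `h𝒢iii`, `hℋiii` are theorems (abc-iut-L3-t8/abc-iut-w4-d064's `compactInVerticialAt_of_finiteGraph`):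
`arithQuasiGeometricCorrespondenceStatementCompat_ofChartDict_of_finite`.
OWNER SIGN-OFF (v2 of this file, L3-lead ruling α81 (3)): abc-iut-w4-d083's parallel engine
`arithQuasiGeometricCorrespondenceStatementCompat_ofRep` (`ArithThm54iiiUmbrellaOfDictionary.lean`, representative currency,
per-`φ` local openness, chart-currency equivariance `hrepG`/`hrepH`) IMPLIES the statement of this file:
`arithQuasiGeometricCorrespondenceStatementCompat_ofChartDict_of_ofRep` derives every `rep`-binder from the dictionary binders
(`hrepSurj` ⟸ `hfull`, `hrepInj` ⟸ `hfaith`, `hrepG`/`hrepH` ⟸ `hpre`/`hpost` + `hact𝒢`/`hactℋ`, `hrepOpen` ⟸ the dictionary at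
`φ.geom`) — the two v5 files state the same mathematics, the engine under the weaker hypotheses.
REMAINING binders, exhaustively: Thm 5.4 (ii) ×2 and Rmk 5.3.1 ×2 at the produced data (`hIIG hIIH hRG hRH`), the
arithmetic `B^temp` (`btemp`, `haugH hcont hover hbtempφ`), the dictionary (D1)/(D2) above (the cell's recorded merge debt
container `SemiAnbdVocab` ↔ `ProfiniteSemiGraph.Hom`, BridgeResidual (R1)), `hcommB hcommB'`
(`ArithChartBranchAction.hcommB_At` modulo no branch switching), `hsurjG` (Prop 5.2 (iv)), continuity of `e`.
Nothing here bears on [IUTchIII] Cor. 3.12; typed ≠ proved for the inputs.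
-/

namespace Literature.AnabelianGeometry.SemiGraphs

open _root_.CategoryTheory _root_.Topology ProfiniteSemiGraph

universe u v w u₀ uG uH

variable {Obj : Type u} [Category.{v} Obj] {𝓥 : SemiAnbdVocab.{u, v, w} Obj}
variable {𝔊 ℍ : ArithSemiGraph 𝓥} {e : 𝔊.PA ≃* ℍ.PA}
variable {𝒢 ℋ : ProfiniteSemiGraph.{u₀}} {c𝒢 : TemperedPiChart 𝒢} {cℋ : TemperedPiChart ℋ}
variable {Gtp : Type uG} [Group Gtp] [TopologicalSpace Gtp]
variable {Htp : Type uH} [Group Htp] [TopologicalSpace Htp] [IsTopologicalGroup Htp] [T2Space Htp]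

/-- **[SemiAnbd] Theorem 5.4 (iii), COMPATIBLE reading, at the PRODUCED decomposition data, with the datum `ι g` READ
THROUGH THE CHARTS** (junction v5): junction v4 `arithQuasiGeometricCorrespondenceStatementCompat_ofChart` with its
abstract datum `ι` INSTANTIATED at `ι g := ι_ℍ ∘ φ̂ g ∘ ι_𝔾⁻¹` on `Ker aug_𝔊` and its binders `hιG hιH hιinj hιbtemp
hιgeomV hιgeomE hιgeomC hCor39c` DISCHARGED from a dictionary of arrows `dict : (𝔾 ⟶ ℍ') → Hom 𝔾 ℍ'` with chosen
2-cells representing the chart-level `φ̂ g` (faithful, full on locally open arrows, functorial w.r.t. the graph actions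
of `Π_A` up to 2-isomorphism) and the chart-currency `B^temp` requirement `hbtempφ`.  Remaining binders: module docstring.
[cite: MochizukiSemiAnbd2006, Thm 5.4 (iii), p. 66] -/
theorem arithQuasiGeometricCorrespondenceStatementCompat_ofChartDict (augG : Gtp →* 𝔊.PA) (augH : Htp →* ℍ.PA)
    (btemp : (φ : ArithHom 𝓥 𝔊 ℍ) → φ.IsLocallyOpen → ArithHom.IsOverA 𝔊 ℍ e φ → (Gtp →* Htp))
    -- the geometric charts and the produced decomposition data (T54-0 / T54-B producer currency)
    (h𝒢iii : CompactInVerticialAt 𝒢) (hℋiii : CompactInVerticialAt ℋ) (h𝒢 : Cor39Hypotheses 𝒢)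
    (hℋ : Cor39Hypotheses ℋ) (R𝒢 : ChartRepresentatives c𝒢) (Rℋ : ChartRepresentatives cℋ)
    (ι𝒢 : c𝒢.G →* Gtp) (hι𝒢 : Function.Injective ι𝒢) (hι𝒢c : Continuous ι𝒢) (ιℋ : cℋ.G →* Htp)
    (hιℋ : Function.Injective ιℋ) (hιℋe : IsEmbedding ιℋ) (hex𝒢 : ι𝒢.range = augG.ker)
    (hexℋ : ιℋ.range = (e.symm.toMonoidHom.comp augH).ker)
    {actV : 𝔊.PA → 𝒢.graph.Vertex → 𝒢.graph.Vertex} {actE : 𝔊.PA → 𝒢.graph.Edge → 𝒢.graph.Edge}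
    {actB : 𝔊.PA → 𝒢.graph.Branch → 𝒢.graph.Branch} (A𝒢 : ArithChartAction c𝒢 ι𝒢 augG actV actE actB)
    {actV' : 𝔊.PA → ℋ.graph.Vertex → ℋ.graph.Vertex} {actE' : 𝔊.PA → ℋ.graph.Edge → ℋ.graph.Edge}
    {actB' : 𝔊.PA → ℋ.graph.Branch → ℋ.graph.Branch}
    (Aℋ : ArithChartAction cℋ ιℋ (e.symm.toMonoidHom.comp augH) actV' actE' actB')
    -- Thm 5.4 (ii) / Rmk 5.3.1 at the produced data and the arithmetic `B^temp`, verbatim from v4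
    (hIIG : ArithMaximalCompactStatementII (decompositionDataOfChart R𝒢 ι𝒢) augG)
    (hIIH : ArithMaximalCompactStatementII (decompositionDataOfChart Rℋ ιℋ) (e.symm.toMonoidHom.comp augH))
    (hRG : VerticialEdgeLikeCompactAmpleStatement (decompositionDataOfChart R𝒢 ι𝒢) augG)
    (hRH : VerticialEdgeLikeCompactAmpleStatement (decompositionDataOfChart Rℋ ιℋ) (e.symm.toMonoidHom.comp augH))
    (haugH : Continuous (e.symm.toMonoidHom.comp augH))
    (hcont : ∀ (φ : ArithHom 𝓥 𝔊 ℍ) (h₁ : φ.IsLocallyOpen) (h₂ : ArithHom.IsOverA 𝔊 ℍ e φ),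
      Continuous (btemp φ h₁ h₂))
    (hover : ∀ (φ : ArithHom 𝓥 𝔊 ℍ) (h₁ : φ.IsLocallyOpen) (h₂ : ArithHom.IsOverA 𝔊 ℍ e φ),
      (e.symm.toMonoidHom.comp augH).comp (btemp φ h₁ h₂) = augG)
    -- (D1)/(D2): the dictionary of arrows with chosen 2-cells and its chart-level representatives
    (dict : (𝔊.G ⟶ ℍ.G) → Hom 𝒢 ℋ) (θd : ∀ g, (dict g).ConjugatorFamily) (hlo : ∀ g, (dict g).IsLocallyOpen)
    (φc : (𝔊.G ⟶ ℍ.G) → (c𝒢.G →ₜ* cℋ.G))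
    (hφc : ∀ g, Nonempty ((dict g).chartPullbackWith (θd g) c𝒢 cℋ ≅ BTemp.res (φc g)))
    -- (D1c) faithful up to 2-isomorphism; (D1-full) full on locally open arrows up to 2-isomorphism
    (hfaith : ∀ g₁ g₂ : 𝔊.G ⟶ ℍ.G, Nonempty ((dict g₁).chartPullbackWith (θd g₁) c𝒢 cℋ ≅
      (dict g₂).chartPullbackWith (θd g₂) c𝒢 cℋ) → g₁ = g₂)
    (hfull : ∀ F : Hom 𝒢 ℋ, F.IsLocallyOpen → ∀ θ : F.ConjugatorFamily,
      ∃ g : 𝔊.G ⟶ ℍ.G, Nonempty ((dict g).chartPullbackWith (θd g) c𝒢 cℋ ≅ F.chartPullbackWith θ c𝒢 cℋ))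
    -- (D1a)/(D1b): functoriality w.r.t. the graph actions of `Π_A`, and those actions seen on the charts
    (F𝒢 : 𝔊.PA → Hom 𝒢 𝒢) (θ𝒢 : ∀ a, (F𝒢 a).ConjugatorFamily)
    (hact𝒢 : ∀ γ : Gtp, ∃ cγ : c𝒢.G →ₜ* c𝒢.G, (∀ y, ι𝒢 (cγ y) = γ * ι𝒢 y * γ⁻¹) ∧
      Nonempty ((F𝒢 (augG γ)).chartPullbackWith (θ𝒢 (augG γ)) c𝒢 c𝒢 ≅ BTemp.res cγ))
    (hpre : ∀ (a : 𝔊.PA) (g : 𝔊.G ⟶ ℍ.G),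
      Nonempty ((dict ((𝔊.ρ a).hom ≫ g)).chartPullbackWith (θd ((𝔊.ρ a).hom ≫ g)) c𝒢 cℋ ≅
        (dict g).chartPullbackWith (θd g) c𝒢 cℋ ⋙ (F𝒢 a).chartPullbackWith (θ𝒢 a) c𝒢 c𝒢))
    (Fℋ : 𝔊.PA → Hom ℋ ℋ) (θℋ : ∀ a, (Fℋ a).ConjugatorFamily)
    (hactℋ : ∀ η : Htp, ∃ cη : cℋ.G →ₜ* cℋ.G, (∀ z, ιℋ (cη z) = η * ιℋ z * η⁻¹) ∧
      Nonempty ((Fℋ ((e.symm.toMonoidHom.comp augH) η)).chartPullbackWith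
        (θℋ ((e.symm.toMonoidHom.comp augH) η)) cℋ cℋ ≅ BTemp.res cη))
    (hpost : ∀ (a : 𝔊.PA) (g : 𝔊.G ⟶ ℍ.G),
      Nonempty ((dict (g ≫ (ℍ.ρ (e a)).hom)).chartPullbackWith (θd (g ≫ (ℍ.ρ (e a)).hom)) c𝒢 cℋ ≅
        (Fℋ a).chartPullbackWith (θℋ a) cℋ cℋ ⋙ (dict g).chartPullbackWith (θd g) c𝒢 cℋ))
    -- the arithmetic `B^temp` on the geometric part, chart currency (formerly `hιbtemp`)
    (hbtempφ : ∀ (φ : ArithHom 𝓥 𝔊 ℍ) (h₁ : φ.IsLocallyOpen) (h₂ : ArithHom.IsOverA 𝔊 ℍ e φ),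
      ∃ δ ∈ (e.symm.toMonoidHom.comp augH).ker,
        ∀ y : c𝒢.G, btemp φ h₁ h₂ (ι𝒢 y) = δ * ιℋ (φc φ.geom y) * δ⁻¹)
    -- branch commensurators, surjectivity of `aug_𝔊`, continuity of `e` (verbatim from v4)
    (hcommB : ∀ b : 𝒢.graph.Branch, Subgroup.Commensurable.commensurator
      ((decompositionDataOfChart R𝒢 ι𝒢).brGp b ⊓ augG.ker) = (decompositionDataOfChart R𝒢 ι𝒢).brGp b)
    (hcommB' : ∀ b' : ℋ.graph.Branch, Subgroup.Commensurable.commensurator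
      ((decompositionDataOfChart Rℋ ιℋ).brGp b' ⊓ (e.symm.toMonoidHom.comp augH).ker) =
        (decompositionDataOfChart Rℋ ιℋ).brGp b')
    (hsurjG : Function.Surjective augG) (he : Continuous e) :
    Literature.AnabelianGeometry.SemiGraphs.ArithQuasiGeometricCorrespondenceStatementCompat 𝔊 ℍ e augG augH
      btemp := by
  -- the datum `ι g := ι_ℍ ∘ φ̂ g ∘ ι_𝔾⁻¹` on `Ker aug_𝔊`
  obtain ⟨ι, hι⟩ :=
    exists_iotaFamily_of_charts ι𝒢 hι𝒢 augG.ker hex𝒢 ιℋ fun g : 𝔊.G ⟶ ℍ.G => (φc g).toMonoidHom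
  have hι' : ∀ (g : 𝔊.G ⟶ ℍ.G) (x : augG.ker) (y : c𝒢.G), (x : Gtp) = ι𝒢 y → ι g x = ιℋ (φc g y) := hι
  have hsh := fun g : 𝔊.G ⟶ ℍ.G =>
    iotaShadows_of_dict h𝒢iii hℋiii h𝒢 hℋ R𝒢 Rℋ ι𝒢 ιℋ hι𝒢 hιℋ hιℋe augG (e.symm.toMonoidHom.comp augH)
      hex𝒢 hexℋ A𝒢 (dict g) (θd g) (hlo g) (φc g) (hφc g) (ι g) (hι' g)
  exact arithQuasiGeometricCorrespondenceStatementCompat_ofChart augG augH btemp h𝒢iii h𝒢 hℋ.thm37Hypotheses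
    R𝒢 Rℋ ι𝒢 hι𝒢 ιℋ hιℋ hιℋe.continuous hex𝒢 hexℋ A𝒢 Aℋ hIIG hIIH hRG hRH haugH hcont hover ι
    (fun g a γ hγ => hιG_of_dict ι𝒢 ιℋ augG (e.symm.toMonoidHom.comp augH) hex𝒢 hexℋ dict θd φc hφc F𝒢
      θ𝒢 hact𝒢 (fun a g => (𝔊.ρ a).hom ≫ g) hpre ι hι' g a γ hγ)
    (fun g a η hη => hιH_of_dict ι𝒢 ιℋ augG (e.symm.toMonoidHom.comp augH) hex𝒢 hexℋ dict θd φc hφc Fℋ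
      θℋ hactℋ (fun a g => g ≫ (ℍ.ρ (e a)).hom) hpost ι hι' g a η hη)
    (fun g₁ g₂ h => hιinj_of_dict ι𝒢 ιℋ hιℋ augG (e.symm.toMonoidHom.comp augH) hex𝒢 hexℋ dict θd φc hφc
      hfaith ι hι' g₁ g₂ h)
    (fun φ h₁ h₂ => hιbtemp_of_charts ι𝒢 ιℋ augG (e.symm.toMonoidHom.comp augH) hex𝒢 (ι φ.geom)
      (hι φ.geom) (btemp φ h₁ h₂) (hbtempφ φ h₁ h₂))
    (fun g => (hsh g).1) (fun g => (hsh g).2.1) (fun φ _ => (hsh φ.geom).2.2)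
    (fun f hf hov h1 h2 h3 => hCor39c_of_dict h𝒢iii hℋiii h𝒢 hℋ R𝒢 Rℋ ι𝒢 ιℋ hι𝒢 hι𝒢c hιℋ hιℋe augG
      (e.symm.toMonoidHom.comp augH) hex𝒢 hexℋ Aℋ dict θd φc hφc hfull ι hι' f hf hov h1 h2 h3)
    hcommB hcommB' hsurjG he

/-- **Junction v5 at a pair of FINITE graphs of anabelioids**: the same statement with the two Thm 3.7 (iii) binders
`h𝒢iii : CompactInVerticialAt 𝒢`, `hℋiii : CompactInVerticialAt ℋ` DISCHARGED by finiteness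
(`compactInVerticialAt_of_finiteGraph`). [cite: MochizukiSemiAnbd2006, Thm 5.4 (iii), p. 66] -/
theorem arithQuasiGeometricCorrespondenceStatementCompat_ofChartDict_of_finite
    [Finite 𝒢.graph.Vertex] [Finite 𝒢.graph.Edge] [Finite ℋ.graph.Vertex] [Finite ℋ.graph.Edge]
    (augG : Gtp →* 𝔊.PA) (augH : Htp →* ℍ.PA)
    (btemp : (φ : ArithHom 𝓥 𝔊 ℍ) → φ.IsLocallyOpen → ArithHom.IsOverA 𝔊 ℍ e φ → (Gtp →* Htp))
    (h𝒢 : Cor39Hypotheses 𝒢) (hℋ : Cor39Hypotheses ℋ) (R𝒢 : ChartRepresentatives c𝒢)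
    (Rℋ : ChartRepresentatives cℋ) (ι𝒢 : c𝒢.G →* Gtp) (hι𝒢 : Function.Injective ι𝒢) (hι𝒢c : Continuous ι𝒢)
    (ιℋ : cℋ.G →* Htp) (hιℋ : Function.Injective ιℋ) (hιℋe : IsEmbedding ιℋ) (hex𝒢 : ι𝒢.range = augG.ker)
    (hexℋ : ιℋ.range = (e.symm.toMonoidHom.comp augH).ker)
    {actV : 𝔊.PA → 𝒢.graph.Vertex → 𝒢.graph.Vertex} {actE : 𝔊.PA → 𝒢.graph.Edge → 𝒢.graph.Edge}
    {actB : 𝔊.PA → 𝒢.graph.Branch → 𝒢.graph.Branch} (A𝒢 : ArithChartAction c𝒢 ι𝒢 augG actV actE actB)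
    {actV' : 𝔊.PA → ℋ.graph.Vertex → ℋ.graph.Vertex} {actE' : 𝔊.PA → ℋ.graph.Edge → ℋ.graph.Edge}
    {actB' : 𝔊.PA → ℋ.graph.Branch → ℋ.graph.Branch}
    (Aℋ : ArithChartAction cℋ ιℋ (e.symm.toMonoidHom.comp augH) actV' actE' actB')
    (hIIG : ArithMaximalCompactStatementII (decompositionDataOfChart R𝒢 ι𝒢) augG)
    (hIIH : ArithMaximalCompactStatementII (decompositionDataOfChart Rℋ ιℋ) (e.symm.toMonoidHom.comp augH))
    (hRG : VerticialEdgeLikeCompactAmpleStatement (decompositionDataOfChart R𝒢 ι𝒢) augG)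
    (hRH : VerticialEdgeLikeCompactAmpleStatement (decompositionDataOfChart Rℋ ιℋ) (e.symm.toMonoidHom.comp augH))
    (haugH : Continuous (e.symm.toMonoidHom.comp augH))
    (hcont : ∀ (φ : ArithHom 𝓥 𝔊 ℍ) (h₁ : φ.IsLocallyOpen) (h₂ : ArithHom.IsOverA 𝔊 ℍ e φ),
      Continuous (btemp φ h₁ h₂))
    (hover : ∀ (φ : ArithHom 𝓥 𝔊 ℍ) (h₁ : φ.IsLocallyOpen) (h₂ : ArithHom.IsOverA 𝔊 ℍ e φ),
      (e.symm.toMonoidHom.comp augH).comp (btemp φ h₁ h₂) = augG)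
    (dict : (𝔊.G ⟶ ℍ.G) → Hom 𝒢 ℋ) (θd : ∀ g, (dict g).ConjugatorFamily) (hlo : ∀ g, (dict g).IsLocallyOpen)
    (φc : (𝔊.G ⟶ ℍ.G) → (c𝒢.G →ₜ* cℋ.G))
    (hφc : ∀ g, Nonempty ((dict g).chartPullbackWith (θd g) c𝒢 cℋ ≅ BTemp.res (φc g)))
    (hfaith : ∀ g₁ g₂ : 𝔊.G ⟶ ℍ.G, Nonempty ((dict g₁).chartPullbackWith (θd g₁) c𝒢 cℋ ≅
      (dict g₂).chartPullbackWith (θd g₂) c𝒢 cℋ) → g₁ = g₂)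
    (hfull : ∀ F : Hom 𝒢 ℋ, F.IsLocallyOpen → ∀ θ : F.ConjugatorFamily,
      ∃ g : 𝔊.G ⟶ ℍ.G, Nonempty ((dict g).chartPullbackWith (θd g) c𝒢 cℋ ≅ F.chartPullbackWith θ c𝒢 cℋ))
    (F𝒢 : 𝔊.PA → Hom 𝒢 𝒢) (θ𝒢 : ∀ a, (F𝒢 a).ConjugatorFamily)
    (hact𝒢 : ∀ γ : Gtp, ∃ cγ : c𝒢.G →ₜ* c𝒢.G, (∀ y, ι𝒢 (cγ y) = γ * ι𝒢 y * γ⁻¹) ∧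
      Nonempty ((F𝒢 (augG γ)).chartPullbackWith (θ𝒢 (augG γ)) c𝒢 c𝒢 ≅ BTemp.res cγ))
    (hpre : ∀ (a : 𝔊.PA) (g : 𝔊.G ⟶ ℍ.G),
      Nonempty ((dict ((𝔊.ρ a).hom ≫ g)).chartPullbackWith (θd ((𝔊.ρ a).hom ≫ g)) c𝒢 cℋ ≅
        (dict g).chartPullbackWith (θd g) c𝒢 cℋ ⋙ (F𝒢 a).chartPullbackWith (θ𝒢 a) c𝒢 c𝒢))
    (Fℋ : 𝔊.PA → Hom ℋ ℋ) (θℋ : ∀ a, (Fℋ a).ConjugatorFamily)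
    (hactℋ : ∀ η : Htp, ∃ cη : cℋ.G →ₜ* cℋ.G, (∀ z, ιℋ (cη z) = η * ιℋ z * η⁻¹) ∧
      Nonempty ((Fℋ ((e.symm.toMonoidHom.comp augH) η)).chartPullbackWith
        (θℋ ((e.symm.toMonoidHom.comp augH) η)) cℋ cℋ ≅ BTemp.res cη))
    (hpost : ∀ (a : 𝔊.PA) (g : 𝔊.G ⟶ ℍ.G),
      Nonempty ((dict (g ≫ (ℍ.ρ (e a)).hom)).chartPullbackWith (θd (g ≫ (ℍ.ρ (e a)).hom)) c𝒢 cℋ ≅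
        (Fℋ a).chartPullbackWith (θℋ a) cℋ cℋ ⋙ (dict g).chartPullbackWith (θd g) c𝒢 cℋ))
    (hbtempφ : ∀ (φ : ArithHom 𝓥 𝔊 ℍ) (h₁ : φ.IsLocallyOpen) (h₂ : ArithHom.IsOverA 𝔊 ℍ e φ),
      ∃ δ ∈ (e.symm.toMonoidHom.comp augH).ker,
        ∀ y : c𝒢.G, btemp φ h₁ h₂ (ι𝒢 y) = δ * ιℋ (φc φ.geom y) * δ⁻¹)
    (hcommB : ∀ b : 𝒢.graph.Branch, Subgroup.Commensurable.commensurator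
      ((decompositionDataOfChart R𝒢 ι𝒢).brGp b ⊓ augG.ker) = (decompositionDataOfChart R𝒢 ι𝒢).brGp b)
    (hcommB' : ∀ b' : ℋ.graph.Branch, Subgroup.Commensurable.commensurator
      ((decompositionDataOfChart Rℋ ιℋ).brGp b' ⊓ (e.symm.toMonoidHom.comp augH).ker) =
        (decompositionDataOfChart Rℋ ιℋ).brGp b')
    (hsurjG : Function.Surjective augG) (he : Continuous e) :
    Literature.AnabelianGeometry.SemiGraphs.ArithQuasiGeometricCorrespondenceStatementCompat 𝔊 ℍ e augG augH
      btemp :=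
  arithQuasiGeometricCorrespondenceStatementCompat_ofChartDict augG augH btemp compactInVerticialAt_of_finiteGraph
    compactInVerticialAt_of_finiteGraph h𝒢 hℋ R𝒢 Rℋ ι𝒢 hι𝒢 hι𝒢c ιℋ hιℋ hιℋe hex𝒢 hexℋ A𝒢 Aℋ hIIG hIIH hRG hRH
    haugH hcont hover dict θd hlo φc hφc hfaith hfull F𝒢 θ𝒢 hact𝒢 hpre Fℋ θℋ hactℋ hpost hbtempφ hcommB hcommB'
    hsurjG he

/-- **Bridge (owner sign-off of junction v5)**: the dict-currency statement `…_ofChartDict` (abc-iut-w5-d141, p436919)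
is a COROLLARY of abc-iut-w4-d083's representative-currency engine `…_ofRep` (p436499): `rep := φ̂`, `hrepOpen` from the
dictionary at `φ.geom`, `hrepSurj` from fullness, `hrepG`/`hrepH` from the functoriality 2-isomorphisms and `hact` (read at
`x = ι_𝔾 y` through `hιG_of_dict`/`hιH_of_dict`), `hrepInj` from faithfulness, `hbtempRep := hbtempφ` — the two v5 files
state the same mathematics, the engine under the weaker (chart-currency, per-`φ`) hypotheses.
[cite: MochizukiSemiAnbd2006, Thm 5.4 (iii), p. 66] -/
theorem arithQuasiGeometricCorrespondenceStatementCompat_ofChartDict_of_ofRep (augG : Gtp →* 𝔊.PA) (augH : Htp →* ℍ.PA)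
    (btemp : (φ : ArithHom 𝓥 𝔊 ℍ) → φ.IsLocallyOpen → ArithHom.IsOverA 𝔊 ℍ e φ → (Gtp →* Htp))
    -- the geometric charts and the produced decomposition data (T54-0 / T54-B producer currency)
    (h𝒢iii : CompactInVerticialAt 𝒢) (hℋiii : CompactInVerticialAt ℋ) (h𝒢 : Cor39Hypotheses 𝒢)
    (hℋ : Cor39Hypotheses ℋ) (R𝒢 : ChartRepresentatives c𝒢) (Rℋ : ChartRepresentatives cℋ)
    (ι𝒢 : c𝒢.G →* Gtp) (hι𝒢 : Function.Injective ι𝒢) (hι𝒢c : Continuous ι𝒢) (ιℋ : cℋ.G →* Htp)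
    (hιℋ : Function.Injective ιℋ) (hιℋe : IsEmbedding ιℋ) (hex𝒢 : ι𝒢.range = augG.ker)
    (hexℋ : ιℋ.range = (e.symm.toMonoidHom.comp augH).ker)
    {actV : 𝔊.PA → 𝒢.graph.Vertex → 𝒢.graph.Vertex} {actE : 𝔊.PA → 𝒢.graph.Edge → 𝒢.graph.Edge}
    {actB : 𝔊.PA → 𝒢.graph.Branch → 𝒢.graph.Branch} (A𝒢 : ArithChartAction c𝒢 ι𝒢 augG actV actE actB)
    {actV' : 𝔊.PA → ℋ.graph.Vertex → ℋ.graph.Vertex} {actE' : 𝔊.PA → ℋ.graph.Edge → ℋ.graph.Edge}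
    {actB' : 𝔊.PA → ℋ.graph.Branch → ℋ.graph.Branch}
    (Aℋ : ArithChartAction cℋ ιℋ (e.symm.toMonoidHom.comp augH) actV' actE' actB')
    -- Thm 5.4 (ii) / Rmk 5.3.1 at the produced data and the arithmetic `B^temp`, verbatim from v4
    (hIIG : ArithMaximalCompactStatementII (decompositionDataOfChart R𝒢 ι𝒢) augG)
    (hIIH : ArithMaximalCompactStatementII (decompositionDataOfChart Rℋ ιℋ) (e.symm.toMonoidHom.comp augH))
    (hRG : VerticialEdgeLikeCompactAmpleStatement (decompositionDataOfChart R𝒢 ι𝒢) augG)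
    (hRH : VerticialEdgeLikeCompactAmpleStatement (decompositionDataOfChart Rℋ ιℋ) (e.symm.toMonoidHom.comp augH))
    (haugH : Continuous (e.symm.toMonoidHom.comp augH))
    (hcont : ∀ (φ : ArithHom 𝓥 𝔊 ℍ) (h₁ : φ.IsLocallyOpen) (h₂ : ArithHom.IsOverA 𝔊 ℍ e φ),
      Continuous (btemp φ h₁ h₂))
    (hover : ∀ (φ : ArithHom 𝓥 𝔊 ℍ) (h₁ : φ.IsLocallyOpen) (h₂ : ArithHom.IsOverA 𝔊 ℍ e φ),
      (e.symm.toMonoidHom.comp augH).comp (btemp φ h₁ h₂) = augG)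
    -- (D1)/(D2): the dictionary of arrows with chosen 2-cells and its chart-level representatives
    (dict : (𝔊.G ⟶ ℍ.G) → Hom 𝒢 ℋ) (θd : ∀ g, (dict g).ConjugatorFamily) (hlo : ∀ g, (dict g).IsLocallyOpen)
    (φc : (𝔊.G ⟶ ℍ.G) → (c𝒢.G →ₜ* cℋ.G))
    (hφc : ∀ g, Nonempty ((dict g).chartPullbackWith (θd g) c𝒢 cℋ ≅ BTemp.res (φc g)))
    -- (D1c) faithful up to 2-isomorphism; (D1-full) full on locally open arrows up to 2-isomorphism
    (hfaith : ∀ g₁ g₂ : 𝔊.G ⟶ ℍ.G, Nonempty ((dict g₁).chartPullbackWith (θd g₁) c𝒢 cℋ ≅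
      (dict g₂).chartPullbackWith (θd g₂) c𝒢 cℋ) → g₁ = g₂)
    (hfull : ∀ F : Hom 𝒢 ℋ, F.IsLocallyOpen → ∀ θ : F.ConjugatorFamily,
      ∃ g : 𝔊.G ⟶ ℍ.G, Nonempty ((dict g).chartPullbackWith (θd g) c𝒢 cℋ ≅ F.chartPullbackWith θ c𝒢 cℋ))
    -- (D1a)/(D1b): functoriality w.r.t. the graph actions of `Π_A`, and those actions seen on the charts
    (F𝒢 : 𝔊.PA → Hom 𝒢 𝒢) (θ𝒢 : ∀ a, (F𝒢 a).ConjugatorFamily)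
    (hact𝒢 : ∀ γ : Gtp, ∃ cγ : c𝒢.G →ₜ* c𝒢.G, (∀ y, ι𝒢 (cγ y) = γ * ι𝒢 y * γ⁻¹) ∧
      Nonempty ((F𝒢 (augG γ)).chartPullbackWith (θ𝒢 (augG γ)) c𝒢 c𝒢 ≅ BTemp.res cγ))
    (hpre : ∀ (a : 𝔊.PA) (g : 𝔊.G ⟶ ℍ.G),
      Nonempty ((dict ((𝔊.ρ a).hom ≫ g)).chartPullbackWith (θd ((𝔊.ρ a).hom ≫ g)) c𝒢 cℋ ≅
        (dict g).chartPullbackWith (θd g) c𝒢 cℋ ⋙ (F𝒢 a).chartPullbackWith (θ𝒢 a) c𝒢 c𝒢))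
    (Fℋ : 𝔊.PA → Hom ℋ ℋ) (θℋ : ∀ a, (Fℋ a).ConjugatorFamily)
    (hactℋ : ∀ η : Htp, ∃ cη : cℋ.G →ₜ* cℋ.G, (∀ z, ιℋ (cη z) = η * ιℋ z * η⁻¹) ∧
      Nonempty ((Fℋ ((e.symm.toMonoidHom.comp augH) η)).chartPullbackWith
        (θℋ ((e.symm.toMonoidHom.comp augH) η)) cℋ cℋ ≅ BTemp.res cη))
    (hpost : ∀ (a : 𝔊.PA) (g : 𝔊.G ⟶ ℍ.G),
      Nonempty ((dict (g ≫ (ℍ.ρ (e a)).hom)).chartPullbackWith (θd (g ≫ (ℍ.ρ (e a)).hom)) c𝒢 cℋ ≅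
        (Fℋ a).chartPullbackWith (θℋ a) cℋ cℋ ⋙ (dict g).chartPullbackWith (θd g) c𝒢 cℋ))
    -- the arithmetic `B^temp` on the geometric part, chart currency (formerly `hιbtemp`)
    (hbtempφ : ∀ (φ : ArithHom 𝓥 𝔊 ℍ) (h₁ : φ.IsLocallyOpen) (h₂ : ArithHom.IsOverA 𝔊 ℍ e φ),
      ∃ δ ∈ (e.symm.toMonoidHom.comp augH).ker,
        ∀ y : c𝒢.G, btemp φ h₁ h₂ (ι𝒢 y) = δ * ιℋ (φc φ.geom y) * δ⁻¹)
    -- branch commensurators, surjectivity of `aug_𝔊`, continuity of `e` (verbatim from v4)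
    (hcommB : ∀ b : 𝒢.graph.Branch, Subgroup.Commensurable.commensurator
      ((decompositionDataOfChart R𝒢 ι𝒢).brGp b ⊓ augG.ker) = (decompositionDataOfChart R𝒢 ι𝒢).brGp b)
    (hcommB' : ∀ b' : ℋ.graph.Branch, Subgroup.Commensurable.commensurator
      ((decompositionDataOfChart Rℋ ιℋ).brGp b' ⊓ (e.symm.toMonoidHom.comp augH).ker) =
        (decompositionDataOfChart Rℋ ιℋ).brGp b')
    (hsurjG : Function.Surjective augG) (he : Continuous e) :
    Literature.AnabelianGeometry.SemiGraphs.ArithQuasiGeometricCorrespondenceStatementCompat 𝔊 ℍ e augG augH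
      btemp := by
  obtain ⟨ι, hι⟩ :=
    exists_iotaFamily_of_charts ι𝒢 hι𝒢 augG.ker hex𝒢 ιℋ fun g : 𝔊.G ⟶ ℍ.G => (φc g).toMonoidHom
  have hι' : ∀ (g : 𝔊.G ⟶ ℍ.G) (x : augG.ker) (y : c𝒢.G), (x : Gtp) = ι𝒢 y → ι g x = ιℋ (φc g y) := hι
  have hmem : ∀ y : c𝒢.G, ι𝒢 y ∈ augG.ker := fun y => hex𝒢.le ⟨y, rfl⟩
  refine arithQuasiGeometricCorrespondenceStatementCompat_ofRep augG augH btemp h𝒢iii h𝒢 hℋiii hℋ R𝒢 Rℋ ι𝒢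
    hι𝒢 hι𝒢c ιℋ hιℋ hιℋe hex𝒢 hexℋ A𝒢 Aℋ hIIG hIIH hRG hRH haugH hcont hover φc
    (fun φ _ => ⟨dict φ.geom, θd φ.geom, hlo φ.geom, hφc φ.geom⟩) (fun F θ f' hF hiso => ?_)
    (fun g a γ hγ => ?_) (fun g a η hη => ?_) (fun g₁ g₂ k hk => ?_) hbtempφ hcommB hcommB' hsurjG he
  · -- `hrepSurj` from fullness
    obtain ⟨eF⟩ := hiso
    obtain ⟨g, ⟨eg⟩⟩ := hfull F hF θ
    exact ⟨g, ⟨(hφc g).some.symm ≪≫ eg ≪≫ eF⟩⟩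
  · -- `hrepG` from `hpre` + `hact𝒢`, read at `x = ι_𝔾 y`
    obtain ⟨δ, hδ, h⟩ := hιG_of_dict ι𝒢 ιℋ augG (e.symm.toMonoidHom.comp augH) hex𝒢 hexℋ dict θd φc hφc
      F𝒢 θ𝒢 hact𝒢 (fun a g => (𝔊.ρ a).hom ≫ g) hpre ι hι' g a γ hγ
    refine ⟨δ, hδ, fun y y' hy' => ?_⟩
    have h1 := h ⟨ι𝒢 y, hmem y⟩
    rw [hι' _ ⟨ι𝒢 y, hmem y⟩ y rfl, hι' g _ y' hy'.symm] at h1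
    exact h1
  · -- `hrepH` from `hpost` + `hactℋ`, read at `x = ι_𝔾 y`
    obtain ⟨δ, hδ, h⟩ := hιH_of_dict ι𝒢 ιℋ augG (e.symm.toMonoidHom.comp augH) hex𝒢 hexℋ dict θd φc hφc
      Fℋ θℋ hactℋ (fun a g => g ≫ (ℍ.ρ (e a)).hom) hpost ι hι' g a η hη
    refine ⟨δ, hδ, fun y => ?_⟩
    have h1 := h ⟨ι𝒢 y, hmem y⟩
    rw [hι' _ ⟨ι𝒢 y, hmem y⟩ y rfl, hι' g ⟨ι𝒢 y, hmem y⟩ y rfl] at h1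
    exact h1
  · -- `hrepInj` from faithfulness
    exact hfaith g₁ g₂
      ⟨(hφc g₁).some ≪≫ (BTemp.resIsoOfConj (φc g₂) (φc g₁) k hk).symm ≪≫ (hφc g₂).some.symm⟩

end Literature.AnabelianGeometry.SemiGraphs
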